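import Mathlib.NumberTheory.LSeries.RiemannZeta
import Mathlib.Analysis.Asymptotics.Defs
import Literature.NumberTheory.Sieve.HardyLittlewood
import HarnessLib

/-!
# Named fact: Granville's averaged Hardy–Littlewood–Goldbach equivalent of RH

Grounder file (D-0014 named facts) for the route `RiemannHypothesis/InterimAntSieve`, statement
item stmt-RiemannHypothesis-0013 (**parity.S35**, interim `granville_rh_iff`).

Granville (Funct. Approx. Comment. Math. 37 (2007), Theorem 1A; corrigendum ibid. 38 (2008))
proved: the Riemann Hypothesis is equivalent to `∑_{2N ≤ x} (G(2N) − J(2N)) ≪ x^{3/2+o(1)}`, with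
`G(2N) = ∑_{p+q=2N, p,q prime} log p log q` and `J(2N) = C₂ ∏_{p ∣ N, p > 2} (p−1)/(p−2) · 2N`
(Granville's `C₂ = 2 ∏_{p>2} (1 − 1/(p−1)²) = 1.3203…`, twice `Literature.NumberTheory.Sieve.twinPrimeConst`), so that
`J = Literature.goldbachHLMain` on even arguments. This file records the theorem AS PRINTED:
prime-`log` weights (`goldbachLogCount`), even `N` only.

The statement item stmt-0013 uses instead the `Λ`-weighted count `Literature.NumberTheory.Sieve.goldbachLambdaCount`
summed over all `N ≤ x`. The two averaged error terms differ by (i) the prime-power terms,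
`≍ x^{3/2}` in total (`∑_{p^k ≤ x, k ≥ 2} log p · ψ(x − p^k)`), and (ii) the odd-`N` terms,
`≪ x log x` (`a + b` odd forces a power of `2`), both inside `O(x^{3/2+ε})` by Chebyshev's
bounds; so the item is equivalent to this fact, but only after that elementary translation,
which is not part of the printed theorem.

## References

* A. Granville, *Refinements of Goldbach's conjecture, and the generalized Riemann hypothesis*,
  Funct. Approx. Comment. Math. 37 (2007), part 1, 159–173, Theorem 1A.
* A. Granville, *Corrigendum*, Funct. Approx. Comment. Math. 38 (2008), no. 2, 235–237.
* G. Bhowmik, J.-C. Schlage-Puchta, *Mean representation number of integers as the sum of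
  primes*, Nagoya Math. J. 200 (2010) (the `Λ`-weighted all-`n` average `∑_{n ≤ x} G(n)`).
-/

noncomputable section

open Filter Finset Asymptotics

namespace Literature.NumberTheory.Sieve

/-- Granville's prime-weighted Goldbach count exactly as printed:
`G(N) = ∑_{p + q = N, p, q prime} log p · log q` (ordered pairs of *primes*, no prime powers),
summed over `Finset.antidiagonal N`. Granville, Funct. Approx. Comment. Math. 37 (2007), §1,
display before Theorem 1A. It differs from the `Λ`-weighted `goldbachLambdaCount N` by the terms
in which `a` or `b` is a higher prime power. [cite: Granville2007, §1] -/
def goldbachLogCount (N : ℕ) : ℝ :=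
  ∑ ab ∈ antidiagonal N, if ab.1.Prime ∧ ab.2.Prime then Real.log ab.1 * Real.log ab.2 else 0

/-- **parity.S35** NAMED FACT (Granville's theorem, as printed; A. Granville, *Refinements of
Goldbach's conjecture, and the generalized Riemann hypothesis*, Funct. Approx. Comment. Math. 37
(2007), part 1, 159–173, Theorem 1A; corrigendum, ibid. 38 (2008), 235–237, which weakens the
error term of eq. (1.3) but states that it "is comfortably strong enough to recover Theorem 1A").
"The Riemann Hypothesis is equivalent to the estimate `∑_{2N ≤ x} (G(2N) − J(2N)) ≪ x^{3/2+o(1)}`",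
where `G(2N) = ∑_{p+q=2N} log p log q` (`goldbachLogCount`) and
`J(2N) = C₂ ∏_{p ∣ N, p>2} (p−1)/(p−2) · 2N = goldbachSingularSeries (2N) · 2N = goldbachHLMain (2N)`.
The sum runs over EVEN integers `≤ x` only; `≪ x^{3/2+o(1)}` is rendered as
`∀ ε > 0, … =O[atTop] x^{3/2+ε}` (the tree's convention, cf. `ZeroDensityEstimate`).
Users take `(h : granville_thm1A)`. [cite: Granville2007, Thm 1A] -/
def granville_thm1A : Prop :=
  RiemannHypothesis ↔
    ∀ ε : ℝ, 0 < ε →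
      (fun x : ℕ ↦ ∑ N ∈ (range (x + 1)).filter Even, (goldbachLogCount N - goldbachHLMain N))
        =O[atTop] fun x : ℕ ↦ (x : ℝ) ^ (3 / 2 + ε)

end Literature.NumberTheory.Sieve

end
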